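import Literature.NumberTheory.EllipticCurves.ZpExtensionGaloisTwistRestrict
import Literature.NumberTheory.EllipticCurves.SelmerUnramified
import Literature.NumberTheory.GaloisRepresentations.ContinuousH1ResCocycle
import HarnessLib

/-!
# The twisted module `E[p^J](χ_u)` at a completion: the local map
# `H¹(Γ_{K_v}, E[p^J](χ_u)) → H¹((K_∞)_w, E)` and its compatibility with `twistedTorsionToH1`
# (definitions + theorems)

Topic `NumberTheory/EllipticCurves` (next to `ZpExtensionGaloisTwistRestrict`); namespace `WeierstrassCurve`.
DEFINITIONS WITH BODIES + theorems; no named fact, no instance, no notation.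

For the twisted Poitou–Tate lifting (cell `bsd-2adic`, HOME/t42/DESIGN-T42-ADDENDUM-16.md, bricks (γ₂), (γ_∞),
(ζ); risk (r3)) one needs, at every completion `E = K_v` (finite or infinite place), the commutative square

  `H¹(Γ_K, E[p^J](χ_u)) ——loc_E——→ H¹(Γ_E, E[p^J](χ_u))`
  `        │ twistedTorsionToH1              │ twistedTorsionToLocalH1`
  `        ↓                                 ↓`
  `H¹(K_∞, E[p^∞]) ———localResOver_E———→ H¹(Γ_E ∩ Gal(·/K_∞), E(K̄_E))`

relating the `GaloisRepresentations` library (top row: `galoisCohomology`, `galoisCohomology.res`, where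
Poitou–Tate and the local Tate pairings live) to the `SubgroupSelmer`/`IwasawaSelmer` library (bottom
row: `W.subgroupH1 p (ker κ)`, `W.localResOver`, whose kernel `W.localKerOver` is the Kummer condition of
`Sel_{p^∞}(E/K_∞)` and of the generic lifting `LIFT₁`, file
`Summits/…/ByReductionTypeAtTwoMultTransportTwistedDescentSingle.lean`).

* `WeierstrassCurve.twistedTorsionToLocalH1 W p κ J u hu E` — the right-hand vertical map: restrict to the
  local subgroup `localSubgroup (ker κ) E ≤ Γ_E` (on which the twist is invisible: its image in `Γ_K` lies
  in `ker κ`) and push along `E[p^J] ↪ E[p^∞] ↪ E(K̄) → E(K̄_E)` (`pointsMap`);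
* **`WeierstrassCurve.localResOver_twistedTorsionToH1`** — the square commutes (both composites are the
  map of one compatible pair; checked on explicit cocycles: `res_oneCocycleClass`, `map_oneCocycleClass`).
  Consequently membership of `c′ − c` in `W.localKerOver p (ker κ) E` for `c′ = twistedTorsionToH1 x` is the
  statement `twistedTorsionToLocalH1 (loc_E x) = localResOver c` about the LEVEL-`K` local class `loc_E x`
  (`twistedTorsionToH1_sub_mem_localKerOver_iff`).

References: R. Greenberg, *Iwasawa theory for elliptic curves*, LNM 1716 (1999), §4 pp. 107, 124 (the maps
`H¹(F_Σ/F, M) → H¹(F_Σ/F_∞, M)^Γ` and `𝒫^Σ(M, F) → 𝒫^Σ(M, F_∞)^Γ` for `M = A_s`) [GreenbergLNM1716];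
J.-P. Serre, *Galois Cohomology* (1997), I §2.4, II §1.1 [SerreGaloisCohomology1997].
-/

noncomputable section

open CategoryTheory Field
open scoped ContRepresentation

universe u

namespace WeierstrassCurve

open Literature.NumberTheory.EllipticCurves Literature.NumberTheory.GaloisRepresentations

variable {K : Type u} [Field K] (W : WeierstrassCurve K) (p : ℕ) [Fact p.Prime]
  (κ : ZpExtension K p) (J : ℕ) (u : ℤ) (hu : (p : ℤ) ∣ u - 1)
  (E : Type u) [Field E] [Algebra K E]

/-- The local subgroup `localSubgroup (ker κ) E ≤ Γ_E` maps into `ker κ` under `Γ_E → Γ_K` (definition of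
the local subgroup), so the twist `χ_u` is trivial on it: the coefficient map
`E[p^J] ↪ E[p^∞] ↪ E(K̄) → E(K̄_E)` intertwines `E[p^J](χ_u)|_{Γ_E}` restricted to the local subgroup
with the local points. This is the `TopRep` morphism underlying `twistedTorsionToLocalH1`.
[cite: SerreGaloisCohomology1997, I §2.4, II §1.1] -/
def twistedTorsionLocalHom :
    TopRep.res (subgroupIncl (localSubgroup κ.kerSubgroup E) :
        localSubgroup κ.kerSubgroup E →* absoluteGaloisGroup E)
        ((W.twistedTorsionGaloisModule p κ J u hu).restrictField E).toTopRep ⟶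
      discreteTopRep (localSubgroup κ.kerSubgroup E) (localPoints W E) :=
  TopRep.ofHom
    { toLinearMap :=
        ((pointsMap W E).comp ((W.geomPrimaryTorsion p).subtype.comp
          (AddSubgroup.inclusion
            (Literature.Barriers.BirchSwinnertonDyer.geomTorsion_pow_le_geomPrimaryTorsion W p J)))).toIntLinearMap
      cont := continuous_of_discreteTopology
      isIntertwining' := fun τ ↦ by
        have hτ : resGal (K := K) E (τ : absoluteGaloisGroup E) ∈ κ.kerSubgroup :=
          (mem_localSubgroup_iff κ.kerSubgroup E _).mp τ.2
        ext m
        change pointsMap W E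
            (((W.twistedTorsionGaloisModule p κ J u hu (resGal (K := K) E (τ : absoluteGaloisGroup E)) m :
                W.geomTorsion ((p ^ J : ℕ) : ℤ)) : W.geomPoints)) =
          (τ : absoluteGaloisGroup E) • pointsMap W E ((m : W.geomTorsion ((p ^ J : ℕ) : ℤ)) : W.geomPoints)
        rw [ZpExtension.galoisTwist_apply_of_mem_kerSubgroup _ _ _ _ _ _ hτ,
          torsionGaloisModule_apply_apply, ← pointsMap_smul]
        rfl }

/-- **`H¹(Γ_E, E[p^J](χ_u)|_E) →+ H¹((K_∞)_w E, E(K̄_E))`** (`discreteH1 (localSubgroup (ker κ) E) (localPoints W E)`,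
the target of `W.localResOver p (ker κ) E`): restriction to the local subgroup and change of coefficients
`E[p^J] → E(K̄_E)`. Greenberg's `𝒫^{(v)}(M, F) → 𝒫^{(v)}(M, F_∞)` for `M = A_s` before passing to the
quotient by the local condition (p. 124). [cite: GreenbergLNM1716, §4 p. 124] -/
def twistedTorsionToLocalH1 :
    galoisCohomology ((W.twistedTorsionGaloisModule p κ J u hu).restrictField E) 1 →+
      discreteH1 (localSubgroup κ.kerSubgroup E) (localPoints W E) :=
  (ContinuousCohomology.map (subgroupIncl (localSubgroup κ.kerSubgroup E))
    (W.twistedTorsionLocalHom p κ J u hu E) 1).hom.toLinearMap.toAddMonoidHom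

/-- `twistedTorsionToLocalH1` on an explicit cocycle. [cite: SerreGaloisCohomology1997, I §2.4] -/
theorem twistedTorsionToLocalH1_oneCocycleClass
    (ξ : contOneCocycles ((W.twistedTorsionGaloisModule p κ J u hu).restrictField E).toTopRep) :
    W.twistedTorsionToLocalH1 p κ J u hu E (oneCocycleClass _ ξ) =
      oneCocycleClass _ (contOneCocycles.pullback (subgroupIncl (localSubgroup κ.kerSubgroup E))
        (W.twistedTorsionLocalHom p κ J u hu E) ξ) :=
  map_oneCocycleClass _ _ _ ξ

/-- `twistedTorsionToH1` on an explicit cocycle: the class of `h ↦ ξ(h)` pushed into `E[p^∞]`.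
[cite: SerreGaloisCohomology1997, I §2.4] -/
theorem twistedTorsionToH1_oneCocycleClass
    (ξ : contOneCocycles (W.twistedTorsionGaloisModule p κ J u hu).toTopRep) :
    W.twistedTorsionToH1 p κ J u hu (oneCocycleClass _ ξ) =
      oneCocycleClass _ (contOneCocycles.push
        (AddSubgroup.inclusion
          (Literature.Barriers.BirchSwinnertonDyer.geomTorsion_pow_le_geomPrimaryTorsion W p J))
        (fun _ _ ↦ rfl)
        (contOneCocycles.pullback κ.kerSubgroupIncl
          (κ.galoisTwistResHom (W.torsionGaloisModule ((p ^ J : ℕ) : ℤ)) (fun _ _ ↦ rfl) J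
            (W.pow_nsmul_geomTorsion_pow p J) u hu) ξ)) := by
  rw [twistedTorsionToH1, ZpExtension.galoisTwistRestrictTo_apply,
    ZpExtension.galoisTwistRestrict_oneCocycleClass]
  exact map_oneCocycleClass _ _ _ _

/-- The compatible pair `(Γ_E ∩ res⁻¹(ker κ) → ker κ, E[p^∞] → E(K̄_E))` defining `W.localResOver p (ker κ) E`
(equivariance of `pointsMap`, as in `SubgroupSelmer`). [cite: SerreGaloisCohomology1997, I §2.4] -/
theorem localResOver_compatible (τ : localSubgroup κ.kerSubgroup E) (P : W.geomPrimaryTorsion p) :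
    ((pointsMapOfEmb W (closureEmb (K := K) E)).comp (W.geomPrimaryTorsion p).subtype)
        (resGalSubgroupOfEmb κ.kerSubgroup (closureEmb (K := K) E) τ • P) =
      τ • ((pointsMapOfEmb W (closureEmb (K := K) E)).comp (W.geomPrimaryTorsion p).subtype) P :=
  pointsMapOfEmb_smul W _ (τ : absoluteGaloisGroup E) (P : W.geomPoints)

/-- `W.localResOver p (ker κ) E` on an explicit cocycle: the class of `τ ↦ pointsMap (f (τ|_{K̄}))` on the
local subgroup (`map_oneCocycleClass`). [cite: SerreGaloisCohomology1997, I §2.4] -/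
theorem localResOver_kerSubgroup_oneCocycleClass
    (f : contOneCocycles (discreteTopRep κ.kerSubgroup (W.geomPrimaryTorsion p))) :
    W.localResOver p κ.kerSubgroup E (oneCocycleClass _ f) =
      oneCocycleClass _
        (contOneCocycles.pullback (resGalSubgroupOfEmb κ.kerSubgroup (closureEmb (K := K) E))
          (resHomOfEquivariant (resGalSubgroupOfEmb κ.kerSubgroup (closureEmb (K := K) E))
            ((pointsMapOfEmb W (closureEmb (K := K) E)).comp (W.geomPrimaryTorsion p).subtype)
            (W.localResOver_compatible p κ E)) f) :=
  map_oneCocycleClass _ _ _ f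

/-- **The square commutes: `localResOver_E ∘ twistedTorsionToH1 = twistedTorsionToLocalH1 ∘ loc_E`.**
For every `x ∈ H¹(Γ_K, E[p^J](χ_u))`, the local restriction at `E` (over `K_∞`, `W.localResOver`) of its
image `c′ ∈ H¹(K_∞, E[p^∞])` is the image of its level-`K` localisation
`galoisCohomology.res _ E 1 x ∈ H¹(Γ_E, E[p^J](χ_u))`. (Both are the class of the cocycle
`τ ↦ ι(ξ(τ|_{K̄}))` on the local subgroup.) [cite: GreenbergLNM1716, §4 p. 124]
[cite: SerreGaloisCohomology1997, I §2.4] -/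
theorem localResOver_twistedTorsionToH1
    (x : galoisCohomology (W.twistedTorsionGaloisModule p κ J u hu) 1) :
    W.localResOver p κ.kerSubgroup E (W.twistedTorsionToH1 p κ J u hu x) =
      W.twistedTorsionToLocalH1 p κ J u hu E
        (galoisCohomology.res (W.twistedTorsionGaloisModule p κ J u hu) E 1 x) := by
  obtain ⟨ξ, rfl⟩ := oneCocycleClass_surjective _ x
  rw [twistedTorsionToH1_oneCocycleClass, galoisCohomology.res_oneCocycleClass,
    twistedTorsionToLocalH1_oneCocycleClass, localResOver_kerSubgroup_oneCocycleClass]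
  congr 1

/-- **Corollary (the local clauses of `LIFT₁` at level `K`).** For `x ∈ H¹(Γ_K, E[p^J](χ_u))`,
`c ∈ H¹(K_∞, E[p^∞])` and a completion `E`: `twistedTorsionToH1 x − c ∈ W.localKerOver p (ker κ) E`
iff the level-`K` local class of `x` maps to `localResOver c`:
`twistedTorsionToLocalH1 (loc_E x) = localResOver_E c`. [cite: GreenbergLNM1716, §4 p. 124] -/
theorem twistedTorsionToH1_sub_mem_localKerOver_iff
    (x : galoisCohomology (W.twistedTorsionGaloisModule p κ J u hu) 1)
    (c : W.subgroupH1 p κ.kerSubgroup) :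
    W.twistedTorsionToH1 p κ J u hu x - c ∈ W.localKerOver p κ.kerSubgroup E ↔
      W.twistedTorsionToLocalH1 p κ J u hu E
          (galoisCohomology.res (W.twistedTorsionGaloisModule p κ J u hu) E 1 x) =
        W.localResOver p κ.kerSubgroup E c := by
  rw [W.mem_localKerOver_iff, map_sub, sub_eq_zero, localResOver_twistedTorsionToH1]

end WeierstrassCurve

end
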